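import Summits.MatrixMultiplication.OmegaCensus.ThreeSetZ19Cells456
import Summits.MatrixMultiplication.OmegaCensus.DominoNormCongruenceTPP
import Summits.MatrixMultiplication.OmegaCensus.CubeLawNoCosetPartThreeSix
import Summits.MatrixMultiplication.OmegaCensus.DihedralLawModOneOrder784
import Summits.MatrixMultiplication.OmegaCensus.DihedralLawModOneOrder361Arith
import HarnessLib

/-!
# ORDER 361 — `Dih(ℤ_19²)` attains no law: the `|A| ≡ 1 (mod 3)` classification line `|A| = 361` as ONE kernel theorem

ω-census `pub-omega`, family (b3), seat pub-omega-group gen 39.  Framing: lottery ticket; floor = certified bounds/negative ranges.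
VALUE: the census line `|A| = 361` as ONE KERNEL THEOREM: no dihedral-like group over an abelian group `A` of order `361` mapping onto `ℤ_19²`
(`A = ℤ_19²`) has a TPP triple attaining `3|S||T||U| + 8 = 8|A|`.  Assembly: non-cube shapes ⇒ two cosets of a cyclic subgroup (orders `≤ 19`);
cube shapes `stu = 120` (`cube_factor_of_361_ordered`, `90` ordered factorisations): two parts `1` / a part `2` ⇒ an element of order `≥ |A|/2`;
dominoes by the norm congruence (`no_domino_law_onto_zpzp_sq`, gen 30); a coset part `3` by the Conway–Lagarias bound (gen 35) with exponent `19`;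
the three-set cell with a part `4` by `no_law_cube_four_5_card361` (`ThreeSetZ19Cells456`: W-killers + in-kernel inverse certificates).  NOT progress on ω.
-/

namespace Summit.MatrixMultiplication.OmegaCensus

open Literature.Combinatorics.Additive Finset

section DihedralLike

variable {A : Type} [AddCommGroup A] [DecidableEq A] [Fintype A] {G : Type} [Group G] [DecidableEq G]
  {ρ τ : A → G} {c₀ : A} {S T U : Finset G}

/-- **No law over `A` of order `361` with `A ↠ ℤ_19²`** (any presentation constant `c₀`). [folklore] -/
theorem no_mod_one_law_card_361_of_onto_z19z19 (hA : Fintype.card A = 361)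
    (hρρ : ∀ a b, ρ a * ρ b = ρ (a + b)) (hρτ : ∀ a b, ρ a * τ b = τ (b - a))
    (hτρ : ∀ a b, τ a * ρ b = τ (a + b)) (hττ : ∀ a b, τ a * τ b = ρ (c₀ + b - a))
    (hρ : Function.Injective ρ) (hτ : Function.Injective τ) (hne : ∀ a b, ρ a ≠ τ b)
    (hsurj : ∀ g, (∃ a, ρ a = g) ∨ (∃ a, τ a = g))
    (Φ : A →+ ZMod 19 × ZMod 19) (hΦ : Function.Surjective Φ) (h : TripleProductProperty S T U) :
    3 * (S.card * T.card * U.card) + 8 ≠ 8 * Fintype.card A := by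
  haveI : Fact (Nat.Prime 19) := ⟨by norm_num⟩
  intro hV
  have hA2 : Fintype.card A = 19 ^ 2 := by rw [hA]; norm_num
  have hexp : ∀ x : A, addOrderOf x ≤ 1 * 19 :=
    addOrderOf_le_of_onto_card (k := 1) (n := 19) Φ hΦ
      (by rw [Nat.card_eq_fintype_card, hA, Nat.card_prod, Nat.card_zmod])
      (fun q => by
        refine Prod.ext ?_ ?_
        · show 19 • q.1 = 0
          rw [nsmul_eq_mul, ZMod.natCast_self, zero_mul]
        · show 19 • q.2 = 0
          rw [nsmul_eq_mul, ZMod.natCast_self, zero_mul])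
      (by norm_num) (by norm_num)
  have big : ¬ ∃ g : A, Fintype.card A ≤ 2 * addOrderOf g := by
    rintro ⟨g, hg⟩; have := hexp g; rw [hA] at hg; omega
  have hmod : Fintype.card A % 3 = 1 := by rw [hA]
  have hA14 : 14 ≤ Fintype.card A := by rw [hA]; norm_num
  have hA7 : 7 ≤ Fintype.card A := by omega
  have hV_TUS : 3 * (T.card * U.card * S.card) + 8 = 8 * Fintype.card A := by
    rw [show T.card * U.card * S.card = S.card * T.card * U.card by ring]; exact hV
  have hV_UST : 3 * (U.card * S.card * T.card) + 8 = 8 * Fintype.card A := by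
    rw [show U.card * S.card * T.card = S.card * T.card * U.card by ring]; exact hV
  have hTUS : TripleProductProperty T U S := h.rotate
  have hUST : TripleProductProperty U S T := h.rotate.rotate
  by_cases hnc : ((univ.filter fun a : A => ρ a ∈ S).card = (univ.filter fun a : A => τ a ∈ S).card ∧
      (univ.filter fun a : A => ρ a ∈ T).card = (univ.filter fun a : A => τ a ∈ T).card ∧
      (univ.filter fun a : A => ρ a ∈ U).card = (univ.filter fun a : A => τ a ∈ U).card)
  · obtain ⟨hS', hT', hU'⟩ := hnc
    obtain ⟨h3S, h3T, h3U⟩ := cube_law_no_coset_part_three_six hρρ hρτ hτρ hττ hρ hτ hne hsurj h hS' hT' hU' hV 19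
      (fun x => (hexp x).trans (by norm_num)) (by rw [hA]; norm_num)
    have cS := card_eq_parts' hρ hτ hne hsurj S
    have cT := card_eq_parts' hρ hτ hne hsurj T
    have cU := card_eq_parts' hρ hτ hne hsurj U
    set s₀ := (univ.filter fun a : A => ρ a ∈ S).card with hs₀
    set t₀ := (univ.filter fun a : A => ρ a ∈ T).card with ht₀
    set u₀ := (univ.filter fun a : A => ρ a ∈ U).card with hu₀
    have eS : S.card = 2 * s₀ := by rw [cS, ← hS']; ring
    have eT : T.card = 2 * t₀ := by rw [cT, ← hT']; ring
    have eU : U.card = 2 * u₀ := by rw [cU, ← hU']; ring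
    have hprod : 3 * (s₀ * t₀ * u₀) + 1 = 361 := by
      rw [eS, eT, eU, hA] at hV; nlinarith
    rcases cube_factor_of_361_ordered hprod with ⟨h1, h2, h3⟩ | ⟨h1, h2, h3⟩ | ⟨h1, h2, h3⟩ | ⟨h1, h2, h3⟩ | ⟨h1, h2, h3⟩ | ⟨h1, h2, h3⟩ | ⟨h1, h2, h3⟩ | ⟨h1, h2, h3⟩ | ⟨h1, h2, h3⟩ | ⟨h1, h2, h3⟩ | ⟨h1, h2, h3⟩ | ⟨h1, h2, h3⟩ | ⟨h1, h2, h3⟩ | ⟨h1, h2, h3⟩ | ⟨h1, h2, h3⟩ | ⟨h1, h2, h3⟩ | ⟨h1, h2, h3⟩ | ⟨h1, h2, h3⟩ | ⟨h1, h2, h3⟩ | ⟨h1, h2, h3⟩ | ⟨h1, h2, h3⟩ | ⟨h1, h2, h3⟩ | ⟨h1, h2, h3⟩ | ⟨h1, h2, h3⟩ | ⟨h1, h2, h3⟩ | ⟨h1, h2, h3⟩ | ⟨h1, h2, h3⟩ | ⟨h1, h2, h3⟩ | ⟨h1, h2, h3⟩ | ⟨h1, h2, h3⟩ | ⟨h1,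 h2, h3⟩ | ⟨h1, h2, h3⟩ | ⟨h1, h2, h3⟩ | ⟨h1, h2, h3⟩ | ⟨h1, h2, h3⟩ | ⟨h1, h2, h3⟩ | ⟨h1, h2, h3⟩ | ⟨h1, h2, h3⟩ | ⟨h1, h2, h3⟩ | ⟨h1, h2, h3⟩ | ⟨h1, h2, h3⟩ | ⟨h1, h2, h3⟩ | ⟨h1, h2, h3⟩ | ⟨h1, h2, h3⟩ | ⟨h1, h2, h3⟩ | ⟨h1, h2, h3⟩ | ⟨h1, h2, h3⟩ | ⟨h1, h2, h3⟩ | ⟨h1, h2, h3⟩ | ⟨h1, h2, h3⟩ | ⟨h1, h2, h3⟩ | ⟨h1, h2, h3⟩ | ⟨h1, h2, h3⟩ | ⟨h1, h2, h3⟩ | ⟨h1, h2, h3⟩ | ⟨h1, h2, h3⟩ | ⟨h1, h2, h3⟩ | ⟨h1, h2, h3⟩ | ⟨h1, h2, h3⟩ | ⟨h1, h2, h3⟩ | ⟨h1, h2, h3⟩ | ⟨h1, h2, h3⟩ | ⟨h1, h2, h3⟩ | ⟨h1, h2, h3⟩ | ⟨h1, h2, h3⟩ | ⟨h1, h2, h3⟩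 | ⟨h1, h2, h3⟩ | ⟨h1, h2, h3⟩ | ⟨h1, h2, h3⟩ | ⟨h1, h2, h3⟩ | ⟨h1, h2, h3⟩ | ⟨h1, h2, h3⟩ | ⟨h1, h2, h3⟩ | ⟨h1, h2, h3⟩ | ⟨h1, h2, h3⟩ | ⟨h1, h2, h3⟩ | ⟨h1, h2, h3⟩ | ⟨h1, h2, h3⟩ | ⟨h1, h2, h3⟩ | ⟨h1, h2, h3⟩ | ⟨h1, h2, h3⟩ | ⟨h1, h2, h3⟩ | ⟨h1, h2, h3⟩ | ⟨h1, h2, h3⟩ | ⟨h1, h2, h3⟩ | ⟨h1, h2, h3⟩ | ⟨h1, h2, h3⟩ | ⟨h1, h2, h3⟩ | ⟨h1, h2, h3⟩ | ⟨h1, h2, h3⟩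
    · -- (1,1,120)
      exact big (card_le_two_mul_addOrderOf_of_two_two_law hρρ hρτ hτρ hττ hρ hτ hne hsurj hmod hA7 h (by rw [eS, h1]) (by rw [eT, h2]) hV)
    · -- (1,2,60)
      exact big (card_le_two_mul_addOrderOf_of_mod_one_law_card_four hρρ hρτ hτρ hττ hρ hτ hne hsurj hmod hA14 h hV (by rw [eT, h2]))
    · -- (1,3,40)
      exact no_domino_law_onto_zpzp_sq hρρ hρτ hτρ hττ hρ hτ hne hsurj (Or.inr (Or.inr (Or.inl rfl))) Φ hΦ hA2 h h1 (hS'.symm.trans h1) hT' hU' hV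
    · -- (1,4,30)
      exact no_domino_law_onto_zpzp_sq hρρ hρτ hτρ hττ hρ hτ hne hsurj (Or.inr (Or.inr (Or.inl rfl))) Φ hΦ hA2 h h1 (hS'.symm.trans h1) hT' hU' hV
    · -- (1,5,24)
      exact no_domino_law_onto_zpzp_sq hρρ hρτ hτρ hττ hρ hτ hne hsurj (Or.inr (Or.inr (Or.inl rfl))) Φ hΦ hA2 h h1 (hS'.symm.trans h1) hT' hU' hV
    · -- (1,6,20)
      exact no_domino_law_onto_zpzp_sq hρρ hρτ hτρ hττ hρ hτ hne hsurj (Or.inr (Or.inr (Or.inl rfl))) Φ hΦ hA2 h h1 (hS'.symm.trans h1) hT' hU' hV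
    · -- (1,8,15)
      exact no_domino_law_onto_zpzp_sq hρρ hρτ hτρ hττ hρ hτ hne hsurj (Or.inr (Or.inr (Or.inl rfl))) Φ hΦ hA2 h h1 (hS'.symm.trans h1) hT' hU' hV
    · -- (1,10,12)
      exact no_domino_law_onto_zpzp_sq hρρ hρτ hτρ hττ hρ hτ hne hsurj (Or.inr (Or.inr (Or.inl rfl))) Φ hΦ hA2 h h1 (hS'.symm.trans h1) hT' hU' hV
    · -- (1,12,10)
      exact no_domino_law_onto_zpzp_sq hρρ hρτ hτρ hττ hρ hτ hne hsurj (Or.inr (Or.inr (Or.inl rfl))) Φ hΦ hA2 h h1 (hS'.symm.trans h1) hT' hU' hV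
    · -- (1,15,8)
      exact no_domino_law_onto_zpzp_sq hρρ hρτ hτρ hττ hρ hτ hne hsurj (Or.inr (Or.inr (Or.inl rfl))) Φ hΦ hA2 h h1 (hS'.symm.trans h1) hT' hU' hV
    · -- (1,20,6)
      exact no_domino_law_onto_zpzp_sq hρρ hρτ hτρ hττ hρ hτ hne hsurj (Or.inr (Or.inr (Or.inl rfl))) Φ hΦ hA2 h h1 (hS'.symm.trans h1) hT' hU' hV
    · -- (1,24,5)
      exact no_domino_law_onto_zpzp_sq hρρ hρτ hτρ hττ hρ hτ hne hsurj (Or.inr (Or.inr (Or.inl rfl))) Φ hΦ hA2 h h1 (hS'.symm.trans h1) hT' hU' hV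
    · -- (1,30,4)
      exact no_domino_law_onto_zpzp_sq hρρ hρτ hτρ hττ hρ hτ hne hsurj (Or.inr (Or.inr (Or.inl rfl))) Φ hΦ hA2 h h1 (hS'.symm.trans h1) hT' hU' hV
    · -- (1,40,3)
      exact no_domino_law_onto_zpzp_sq hρρ hρτ hτρ hττ hρ hτ hne hsurj (Or.inr (Or.inr (Or.inl rfl))) Φ hΦ hA2 h h1 (hS'.symm.trans h1) hT' hU' hV
    · -- (1,60,2)
      exact big (card_le_two_mul_addOrderOf_of_mod_one_law_card_four hρρ hρτ hτρ hττ hρ hτ hne hsurj hmod hA14 hTUS hV_TUS (by rw [eU, h3]))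
    · -- (1,120,1)
      exact big (card_le_two_mul_addOrderOf_of_two_two_law hρρ hρτ hτρ hττ hρ hτ hne hsurj hmod hA7 hUST (by rw [eU, h3]) (by rw [eS, h1]) hV_UST)
    · -- (2,1,60)
      exact big (card_le_two_mul_addOrderOf_of_mod_one_law_card_four hρρ hρτ hτρ hττ hρ hτ hne hsurj hmod hA14 hUST hV_UST (by rw [eS, h1]))
    · -- (2,2,30)
      exact big (card_le_two_mul_addOrderOf_of_mod_one_law_card_four hρρ hρτ hτρ hττ hρ hτ hne hsurj hmod hA14 h hV (by rw [eT, h2]))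
    · -- (2,3,20)
      exact big (card_le_two_mul_addOrderOf_of_mod_one_law_card_four hρρ hρτ hτρ hττ hρ hτ hne hsurj hmod hA14 hUST hV_UST (by rw [eS, h1]))
    · -- (2,4,15)
      exact big (card_le_two_mul_addOrderOf_of_mod_one_law_card_four hρρ hρτ hτρ hττ hρ hτ hne hsurj hmod hA14 hUST hV_UST (by rw [eS, h1]))
    · -- (2,5,12)
      exact big (card_le_two_mul_addOrderOf_of_mod_one_law_card_four hρρ hρτ hτρ hττ hρ hτ hne hsurj hmod hA14 hUST hV_UST (by rw [eS, h1]))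
    · -- (2,6,10)
      exact big (card_le_two_mul_addOrderOf_of_mod_one_law_card_four hρρ hρτ hτρ hττ hρ hτ hne hsurj hmod hA14 hUST hV_UST (by rw [eS, h1]))
    · -- (2,10,6)
      exact big (card_le_two_mul_addOrderOf_of_mod_one_law_card_four hρρ hρτ hτρ hττ hρ hτ hne hsurj hmod hA14 hUST hV_UST (by rw [eS, h1]))
    · -- (2,12,5)
      exact big (card_le_two_mul_addOrderOf_of_mod_one_law_card_four hρρ hρτ hτρ hττ hρ hτ hne hsurj hmod hA14 hUST hV_UST (by rw [eS, h1]))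
    · -- (2,15,4)
      exact big (card_le_two_mul_addOrderOf_of_mod_one_law_card_four hρρ hρτ hτρ hττ hρ hτ hne hsurj hmod hA14 hUST hV_UST (by rw [eS, h1]))
    · -- (2,20,3)
      exact big (card_le_two_mul_addOrderOf_of_mod_one_law_card_four hρρ hρτ hτρ hττ hρ hτ hne hsurj hmod hA14 hUST hV_UST (by rw [eS, h1]))
    · -- (2,30,2)
      exact big (card_le_two_mul_addOrderOf_of_mod_one_law_card_four hρρ hρτ hτρ hττ hρ hτ hne hsurj hmod hA14 hUST hV_UST (by rw [eS, h1]))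
    · -- (2,60,1)
      exact big (card_le_two_mul_addOrderOf_of_mod_one_law_card_four hρρ hρτ hτρ hττ hρ hτ hne hsurj hmod hA14 hUST hV_UST (by rw [eS, h1]))
    · -- (3,1,40)
      exact no_domino_law_onto_zpzp_sq hρρ hρτ hτρ hττ hρ hτ hne hsurj (Or.inr (Or.inr (Or.inl rfl))) Φ hΦ hA2 hTUS h2 (hT'.symm.trans h2) hU' hS' hV_TUS
    · -- (3,2,20)
      exact big (card_le_two_mul_addOrderOf_of_mod_one_law_card_four hρρ hρτ hτρ hττ hρ hτ hne hsurj hmod hA14 h hV (by rw [eT, h2]))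
    · -- (3,4,10)
      exact h3S h1
    · -- (3,5,8)
      exact h3S h1
    · -- (3,8,5)
      exact h3S h1
    · -- (3,10,4)
      exact h3S h1
    · -- (3,20,2)
      exact big (card_le_two_mul_addOrderOf_of_mod_one_law_card_four hρρ hρτ hτρ hττ hρ hτ hne hsurj hmod hA14 hTUS hV_TUS (by rw [eU, h3]))
    · -- (3,40,1)
      exact no_domino_law_onto_zpzp_sq hρρ hρτ hτρ hττ hρ hτ hne hsurj (Or.inr (Or.inr (Or.inl rfl))) Φ hΦ hA2 hUST h3 (hU'.symm.trans h3) hS' hT' hV_UST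
    · -- (4,1,30)
      exact no_domino_law_onto_zpzp_sq hρρ hρτ hτρ hττ hρ hτ hne hsurj (Or.inr (Or.inr (Or.inl rfl))) Φ hΦ hA2 hTUS h2 (hT'.symm.trans h2) hU' hS' hV_TUS
    · -- (4,2,15)
      exact big (card_le_two_mul_addOrderOf_of_mod_one_law_card_four hρρ hρτ hτρ hττ hρ hτ hne hsurj hmod hA14 h hV (by rw [eT, h2]))
    · -- (4,3,10)
      exact h3T h2
    · -- (4,5,6)
      exact absurd hV (no_law_cube_four_5_card361 hA hρρ hρτ hτρ hττ hρ hτ hne hsurj Φ hΦ h hS' hT' hU' (Or.inl ⟨h1, h2⟩))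
    · -- (4,6,5)
      exact absurd hV (no_law_cube_four_5_card361 hA hρρ hρτ hτρ hττ hρ hτ hne hsurj Φ hΦ h hS' hT' hU' (Or.inr (Or.inr (Or.inr (Or.inr (Or.inr (⟨h3, h1⟩)))))))
    · -- (4,10,3)
      exact h3U h3
    · -- (4,15,2)
      exact big (card_le_two_mul_addOrderOf_of_mod_one_law_card_four hρρ hρτ hτρ hττ hρ hτ hne hsurj hmod hA14 hTUS hV_TUS (by rw [eU, h3]))
    · -- (4,30,1)
      exact no_domino_law_onto_zpzp_sq hρρ hρτ hτρ hττ hρ hτ hne hsurj (Or.inr (Or.inr (Or.inl rfl))) Φ hΦ hA2 hUST h3 (hU'.symm.trans h3) hS' hT' hV_UST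
    · -- (5,1,24)
      exact no_domino_law_onto_zpzp_sq hρρ hρτ hτρ hττ hρ hτ hne hsurj (Or.inr (Or.inr (Or.inl rfl))) Φ hΦ hA2 hTUS h2 (hT'.symm.trans h2) hU' hS' hV_TUS
    · -- (5,2,12)
      exact big (card_le_two_mul_addOrderOf_of_mod_one_law_card_four hρρ hρτ hτρ hττ hρ hτ hne hsurj hmod hA14 h hV (by rw [eT, h2]))
    · -- (5,3,8)
      exact h3T h2
    · -- (5,4,6)
      exact absurd hV (no_law_cube_four_5_card361 hA hρρ hρτ hτρ hττ hρ hτ hne hsurj Φ hΦ h hS' hT' hU' (Or.inr (Or.inr (Or.inr (Or.inl ⟨h1, h2⟩)))))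
    · -- (5,6,4)
      exact absurd hV (no_law_cube_four_5_card361 hA hρρ hρτ hτρ hττ hρ hτ hne hsurj Φ hΦ h hS' hT' hU' (Or.inr (Or.inr (Or.inl ⟨h3, h1⟩))))
    · -- (5,8,3)
      exact h3U h3
    · -- (5,12,2)
      exact big (card_le_two_mul_addOrderOf_of_mod_one_law_card_four hρρ hρτ hτρ hττ hρ hτ hne hsurj hmod hA14 hTUS hV_TUS (by rw [eU, h3]))
    · -- (5,24,1)
      exact no_domino_law_onto_zpzp_sq hρρ hρτ hτρ hττ hρ hτ hne hsurj (Or.inr (Or.inr (Or.inl rfl))) Φ hΦ hA2 hUST h3 (hU'.symm.trans h3) hS' hT' hV_UST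
    · -- (6,1,20)
      exact no_domino_law_onto_zpzp_sq hρρ hρτ hτρ hττ hρ hτ hne hsurj (Or.inr (Or.inr (Or.inl rfl))) Φ hΦ hA2 hTUS h2 (hT'.symm.trans h2) hU' hS' hV_TUS
    · -- (6,2,10)
      exact big (card_le_two_mul_addOrderOf_of_mod_one_law_card_four hρρ hρτ hτρ hττ hρ hτ hne hsurj hmod hA14 h hV (by rw [eT, h2]))
    · -- (6,4,5)
      exact absurd hV (no_law_cube_four_5_card361 hA hρρ hρτ hτρ hττ hρ hτ hne hsurj Φ hΦ h hS' hT' hU' (Or.inr (Or.inl ⟨h2, h3⟩)))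
    · -- (6,5,4)
      exact absurd hV (no_law_cube_four_5_card361 hA hρρ hρτ hτρ hττ hρ hτ hne hsurj Φ hΦ h hS' hT' hU' (Or.inr (Or.inr (Or.inr (Or.inr (Or.inl ⟨h2, h3⟩))))))
    · -- (6,10,2)
      exact big (card_le_two_mul_addOrderOf_of_mod_one_law_card_four hρρ hρτ hτρ hττ hρ hτ hne hsurj hmod hA14 hTUS hV_TUS (by rw [eU, h3]))
    · -- (6,20,1)
      exact no_domino_law_onto_zpzp_sq hρρ hρτ hτρ hττ hρ hτ hne hsurj (Or.inr (Or.inr (Or.inl rfl))) Φ hΦ hA2 hUST h3 (hU'.symm.trans h3) hS' hT' hV_UST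
    · -- (8,1,15)
      exact no_domino_law_onto_zpzp_sq hρρ hρτ hτρ hττ hρ hτ hne hsurj (Or.inr (Or.inr (Or.inl rfl))) Φ hΦ hA2 hTUS h2 (hT'.symm.trans h2) hU' hS' hV_TUS
    · -- (8,3,5)
      exact h3T h2
    · -- (8,5,3)
      exact h3U h3
    · -- (8,15,1)
      exact no_domino_law_onto_zpzp_sq hρρ hρτ hτρ hττ hρ hτ hne hsurj (Or.inr (Or.inr (Or.inl rfl))) Φ hΦ hA2 hUST h3 (hU'.symm.trans h3) hS' hT' hV_UST
    · -- (10,1,12)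
      exact no_domino_law_onto_zpzp_sq hρρ hρτ hτρ hττ hρ hτ hne hsurj (Or.inr (Or.inr (Or.inl rfl))) Φ hΦ hA2 hTUS h2 (hT'.symm.trans h2) hU' hS' hV_TUS
    · -- (10,2,6)
      exact big (card_le_two_mul_addOrderOf_of_mod_one_law_card_four hρρ hρτ hτρ hττ hρ hτ hne hsurj hmod hA14 h hV (by rw [eT, h2]))
    · -- (10,3,4)
      exact h3T h2
    · -- (10,4,3)
      exact h3U h3
    · -- (10,6,2)
      exact big (card_le_two_mul_addOrderOf_of_mod_one_law_card_four hρρ hρτ hτρ hττ hρ hτ hne hsurj hmod hA14 hTUS hV_TUS (by rw [eU, h3]))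
    · -- (10,12,1)
      exact no_domino_law_onto_zpzp_sq hρρ hρτ hτρ hττ hρ hτ hne hsurj (Or.inr (Or.inr (Or.inl rfl))) Φ hΦ hA2 hUST h3 (hU'.symm.trans h3) hS' hT' hV_UST
    · -- (12,1,10)
      exact no_domino_law_onto_zpzp_sq hρρ hρτ hτρ hττ hρ hτ hne hsurj (Or.inr (Or.inr (Or.inl rfl))) Φ hΦ hA2 hTUS h2 (hT'.symm.trans h2) hU' hS' hV_TUS
    · -- (12,2,5)
      exact big (card_le_two_mul_addOrderOf_of_mod_one_law_card_four hρρ hρτ hτρ hττ hρ hτ hne hsurj hmod hA14 h hV (by rw [eT, h2]))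
    · -- (12,5,2)
      exact big (card_le_two_mul_addOrderOf_of_mod_one_law_card_four hρρ hρτ hτρ hττ hρ hτ hne hsurj hmod hA14 hTUS hV_TUS (by rw [eU, h3]))
    · -- (12,10,1)
      exact no_domino_law_onto_zpzp_sq hρρ hρτ hτρ hττ hρ hτ hne hsurj (Or.inr (Or.inr (Or.inl rfl))) Φ hΦ hA2 hUST h3 (hU'.symm.trans h3) hS' hT' hV_UST
    · -- (15,1,8)
      exact no_domino_law_onto_zpzp_sq hρρ hρτ hτρ hττ hρ hτ hne hsurj (Or.inr (Or.inr (Or.inl rfl))) Φ hΦ hA2 hTUS h2 (hT'.symm.trans h2) hU' hS' hV_TUS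
    · -- (15,2,4)
      exact big (card_le_two_mul_addOrderOf_of_mod_one_law_card_four hρρ hρτ hτρ hττ hρ hτ hne hsurj hmod hA14 h hV (by rw [eT, h2]))
    · -- (15,4,2)
      exact big (card_le_two_mul_addOrderOf_of_mod_one_law_card_four hρρ hρτ hτρ hττ hρ hτ hne hsurj hmod hA14 hTUS hV_TUS (by rw [eU, h3]))
    · -- (15,8,1)
      exact no_domino_law_onto_zpzp_sq hρρ hρτ hτρ hττ hρ hτ hne hsurj (Or.inr (Or.inr (Or.inl rfl))) Φ hΦ hA2 hUST h3 (hU'.symm.trans h3) hS' hT' hV_UST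
    · -- (20,1,6)
      exact no_domino_law_onto_zpzp_sq hρρ hρτ hτρ hττ hρ hτ hne hsurj (Or.inr (Or.inr (Or.inl rfl))) Φ hΦ hA2 hTUS h2 (hT'.symm.trans h2) hU' hS' hV_TUS
    · -- (20,2,3)
      exact big (card_le_two_mul_addOrderOf_of_mod_one_law_card_four hρρ hρτ hτρ hττ hρ hτ hne hsurj hmod hA14 h hV (by rw [eT, h2]))
    · -- (20,3,2)
      exact big (card_le_two_mul_addOrderOf_of_mod_one_law_card_four hρρ hρτ hτρ hττ hρ hτ hne hsurj hmod hA14 hTUS hV_TUS (by rw [eU, h3]))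
    · -- (20,6,1)
      exact no_domino_law_onto_zpzp_sq hρρ hρτ hτρ hττ hρ hτ hne hsurj (Or.inr (Or.inr (Or.inl rfl))) Φ hΦ hA2 hUST h3 (hU'.symm.trans h3) hS' hT' hV_UST
    · -- (24,1,5)
      exact no_domino_law_onto_zpzp_sq hρρ hρτ hτρ hττ hρ hτ hne hsurj (Or.inr (Or.inr (Or.inl rfl))) Φ hΦ hA2 hTUS h2 (hT'.symm.trans h2) hU' hS' hV_TUS
    · -- (24,5,1)
      exact no_domino_law_onto_zpzp_sq hρρ hρτ hτρ hττ hρ hτ hne hsurj (Or.inr (Or.inr (Or.inl rfl))) Φ hΦ hA2 hUST h3 (hU'.symm.trans h3) hS' hT' hV_UST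
    · -- (30,1,4)
      exact no_domino_law_onto_zpzp_sq hρρ hρτ hτρ hττ hρ hτ hne hsurj (Or.inr (Or.inr (Or.inl rfl))) Φ hΦ hA2 hTUS h2 (hT'.symm.trans h2) hU' hS' hV_TUS
    · -- (30,2,2)
      exact big (card_le_two_mul_addOrderOf_of_mod_one_law_card_four hρρ hρτ hτρ hττ hρ hτ hne hsurj hmod hA14 h hV (by rw [eT, h2]))
    · -- (30,4,1)
      exact no_domino_law_onto_zpzp_sq hρρ hρτ hτρ hττ hρ hτ hne hsurj (Or.inr (Or.inr (Or.inl rfl))) Φ hΦ hA2 hUST h3 (hU'.symm.trans h3) hS' hT' hV_UST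
    · -- (40,1,3)
      exact no_domino_law_onto_zpzp_sq hρρ hρτ hτρ hττ hρ hτ hne hsurj (Or.inr (Or.inr (Or.inl rfl))) Φ hΦ hA2 hTUS h2 (hT'.symm.trans h2) hU' hS' hV_TUS
    · -- (40,3,1)
      exact no_domino_law_onto_zpzp_sq hρρ hρτ hτρ hττ hρ hτ hne hsurj (Or.inr (Or.inr (Or.inl rfl))) Φ hΦ hA2 hUST h3 (hU'.symm.trans h3) hS' hT' hV_UST
    · -- (60,1,2)
      exact big (card_le_two_mul_addOrderOf_of_mod_one_law_card_four hρρ hρτ hτρ hττ hρ hτ hne hsurj hmod hA14 hTUS hV_TUS (by rw [eU, h3]))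
    · -- (60,2,1)
      exact big (card_le_two_mul_addOrderOf_of_mod_one_law_card_four hρρ hρτ hτρ hττ hρ hτ hne hsurj hmod hA14 h hV (by rw [eT, h2]))
    · -- (120,1,1)
      exact big (card_le_two_mul_addOrderOf_of_two_two_law hρρ hρτ hτρ hττ hρ hτ hne hsurj hmod hA7 hTUS (by rw [eT, h2]) (by rw [eU, h3]) hV_TUS)
  · obtain ⟨g, a, b, hab⟩ :=
      two_cosets_of_mod_one_law_of_not_cube hρρ hρτ hτρ hττ hρ hτ hne hsurj hmod hA14 h hV hnc
    exact big ⟨g, card_le_two_mul_addOrderOf_of_two_cosets hab⟩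

end DihedralLike

section Instance

variable {G : Type} [Group G] [DecidableEq G] {S T U : Finset G}

open Literature.Combinatorics.Additive

/-- **`Dih(ℤ_19 × ℤ_19)` — and every dihedral-like group over `ℤ_19²` — has no TPP triple attaining `3|S||T||U| + 8 = 8|A|`**
(the `|A| = 361` line of the classification 'law ⟹ an element of order `≥ |A|/2`'). [folklore] -/
theorem no_mod_one_law_z19_z19 {ρ τ : ZMod 19 × ZMod 19 → G} {c₀ : ZMod 19 × ZMod 19}
    (hρρ : ∀ a b, ρ a * ρ b = ρ (a + b)) (hρτ : ∀ a b, ρ a * τ b = τ (b - a))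
    (hτρ : ∀ a b, τ a * ρ b = τ (a + b)) (hττ : ∀ a b, τ a * τ b = ρ (c₀ + b - a))
    (hρ : Function.Injective ρ) (hτ : Function.Injective τ) (hne : ∀ a b, ρ a ≠ τ b)
    (hsurj : ∀ g, (∃ a, ρ a = g) ∨ (∃ a, τ a = g)) (h : TripleProductProperty S T U) :
    3 * (S.card * T.card * U.card) + 8 ≠ 8 * Fintype.card (ZMod 19 × ZMod 19) :=
  no_mod_one_law_card_361_of_onto_z19z19 (by simp [Fintype.card_prod, ZMod.card]) hρρ hρτ hτρ hττ hρ hτ hne hsurj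
    (AddMonoidHom.id _) (fun q => ⟨q, rfl⟩) h

end Instance

end Summit.MatrixMultiplication.OmegaCensus
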